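import Summits.QuantumFields.QCD.Theorems.NestedDissectionSeaRobustYangMillsStubDeploymentUKP
import Literature.Probability.LatticeModels.CoarseCellMixingDefectsBlockLeak
import Literature.Probability.LatticeModels.CoarseCellMixingPeierls
import Literature.Probability.LatticeModels.CoarseCellMixingDefectsAnnealed
import Literature.MathematicalPhysics.QuantumFieldTheory.QuasiLocalGaugePerturbationBlockLeak

/-!
# Line `local-ac-open-certificate` for the crux `RobustYangMills` (stmt-QuantumFields-13897) —
# reshape r5: the DRESSED engine (polymer currency) and the CLOSED stub `stub_deploymentDressed`

Crux: `Summit.QuantumFields.QCD.Theses.NestedDissectionSea.RobustYangMills` (shared verbatim with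
`HeavyThresholdYMBridge` / `AdaptiveBlockFermions`); checked skeleton
`Cruxes/RobustYangMills/Lines/local_ac_open_certificate.lean`; companion modules
`NestedDissectionSeaRobustYangMillsLocalAC` (§0–§1: `spec`, `wilsonSpec`, `LocalACToolkit`,
`stub_localAC`), `NestedDissectionSeaRobustYangMillsStubDeployment{,UKP}` (`WilsonGoodCertificateUKP`,
`IRConeClustering`, `level_numerics`, `final_numeric`, `level_bound`, `stub_deploymentUKP`) and
`NestedDissectionSeaRobustYangMillsEngineBQL` (reshape r4: the ABSTRACT quasi-local engine
`AnnealedEngineBQL` over `HasBlockLeak`, `PerturbedMixingEngineBQL`, `DeploymentBQL`).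

**Why r5 (continuation lead c6, 2026-08-16).** The one registered stub of this line that is provable
mathematics and survives the restatement of clause (iv) is the engine. Leads c2/c3 showed that its
abstract r4 form `AnnealedEngineBQL` (one specification, block quasi-locality `HasBlockLeak cell γ a r`,
`0 < a ≤ a₀`) is not reachable by any sup-norm / total-variation form of the Dobrushin–Shlosman block
recursion ((E) multi-cell influence with defects is exponential in the support, (P) a leak forces
supports polynomial in the distance; `Lines/local-ac-open-certificate-c2-engine.md`), and lead c4's
only surviving architecture (Variant C, `Lines/local-ac-open-certificate-c4-variantC.md`: exact
Bernoulli decoupling `e^{-W_X} = (1-p_X) + p_X g_X` of the far polymers, the landed `a = 0` induction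
run in the JOINT system with active polymers as a second Peierls species) proves NOT the abstract
kernel-level statement but the measure-level, polymer-currency statement typed by lead c3 as
`DressedGaugeEngine d` (`Lines/local_ac_open_certificate_engine_variants.lean`, Variant B; c4 trap 5).
This module therefore carries the r5 vocabulary:

* `DressedGaugeEngine d` — Variant B with two corrections: (1) the reference finite-size condition is
  taken at `2ε·shellCount d n ≤ 1`, exactly as `WilsonGoodCertificateUKP` delivers it (and as
  `PerturbedMixingEngineBQL` takes it), so that the near-dressing of the reference kernels (local a.c.
  at rate `O(η₀)`, `isGoodFS_of_isLocallyAC`) has finite-size room `1/(4·shellCount d n)` with a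
  threshold `η₀ = η₀(n)` chosen BEFORE `ε` — at `ε·shellCount = 3/4` (Variant B as typed) no dressing
  room is left for the contraction of the landed engine; (2) the DLR data of the reference and of the
  dressed kernels (`IsSpecification`, `IsGibbsMeasure … (W.perturbedMeasure ρ β)`) are explicit
  hypotheses, supplied by toolkit (c) `KernelDLR` in the deployment, so that the engine is a statement
  of classical probability about the given kernels. Statement of the OPEN stub `stub_dressedEngine`
  (item-sized: to be promoted);
* `DeploymentDressed` — toolkit + dressed engine + UKP-certificate ⇒ uniform IR clustering of the
  translation-invariant sup-small range-controlled cone for every `κ ≥ κ₀` (the engine's rate threshold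
  at the certificate's window), statement of the CLOSED stub `stub_deploymentDressed`, PROVED here:
  the frames / level numerics of the landed `stub_deploymentUKP`, the engine called directly on the
  cone member `w` (its kernels ARE `w.kernel ρ₃ β = spec ρ₃ β w`, Wilson's are
  `(0 : …).kernel ρ₃ β = wilsonSpec ρ₃ β`, both by `rfl`), blocks-per-cell `K = 10⁴`
  (`card_image_blockCorner_le_mul_cellCount`), block-to-cell nearness
  (`cdist_cellOf_le_of_blockCorner_near`), budget `η₁ := η₀/10⁴`, and the one-level species bound with
  the engine factor `e^{|Δf|}` (`level_bound_exp`, landed in `…WilsonSlice`; re-proved privately here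
  while that module is unbuilt on the farm). Output: `c₁ = c₁(p₀(n))`, `κ₀ = κ₀(n)`, `η₁ = η₀(n)/10⁴`,
  `Δ = κₑ/(6ℓ₀)`;
* `dressedGaugeEngine_zero` — NON-VACUITY / the `W = 0` slice in every dimension `d`: the body of
  `DressedGaugeEngine d` at `W = 0` follows from the PROVED block-Markov engine
  `Literature.Probability.LatticeModels.annealed_influence_markov_defects` (Wilson's kernels are
  block-Markov through cells, `hasBlockLeak_kernel_zero`) in covariance form.

Sources: van den Berg–Maes, Ann. Probab. 22 (1994) §2; Dobrushin–Shlosman (1985) §2 and J. Stat.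
Phys. 46 (1987); Georgii (2011) §8.2, Rem. 1.24; Bertini–Cirillo–Olivieri, CMP 258 (2005);
Olivieri–Picco, JSP 59 (1990); Osterwalder–Seiler, Ann. Phys. 110 (1978) §2.
-/

set_option autoImplicit false

noncomputable section

namespace Summit.QuantumFields.QCD.Cruxes.RobustYangMills.LocalAcOpenCertificate

open scoped BigOperators Topology ENNReal
open Filter MeasureTheory
open Literature.MathematicalPhysics.QuantumLattice Literature.MathematicalPhysics.AQFT
  Literature.MathematicalPhysics.QuantumFieldTheory
open Literature.Probability.LatticeModels (CoarseIdx cdist shellCount cellCount IsGoodFS HasBlockLeak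
  UniformKernelPeierls IsTorusFrame isTorusFrame_axisFrame Specification IsSpecification IsGibbsMeasure
  abs_covariance_le_integral_abs integral_abs_kernel_sub_rescale)

/-! ## §2‴ Reshape r5: the dressed engine (statement of the OPEN stub `stub_dressedEngine`) -/

/-- **The dressed gauge engine** (polymer currency; statement of the OPEN, item-sized stub
`stub_dressedEngine`; `d`-dimensional tori, any compact second-countable gauge group, any
finite-dimensional continuous representation): for every window `n ≥ 1` there are thresholds
`p₀, η₀, κ₀ > 0` and, for every finite-size threshold `ε ≥ 0` with `2ε·shellCount d n ≤ 1`, a rate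
`κₑ > 0` and a constant `C₀ ≥ 0` such that: whenever the cells (`≥ 4n+3` per axis) meet at most `K`
blocks per cell and contract block nearness, Wilson's kernels at coupling `β` and the dressed kernels
are specifications with `μ_{β,W}` Gibbs for the latter, Wilson's kernels satisfy the good-exterior
finite-size condition `(n, ε)` and the kernel-uniform Peierls bound at level `p ≤ p₀` for some
cell-local good sets, and the dressing `W` (block scale `b ≥ 1`) has `‖W‖_{b,κ} ≤ η` with `κ ≥ κ₀`,
`η·K ≤ η₀` and range control (h4), then `μ_{β,W}` has covariance decay
`|⟨fg⟩ − ⟨f⟩⟨g⟩| ≤ C₀ B_f B_g e^{|Δf|} |Δg| e^{−κₑ D}` for bounded measurable cell-local `f, g` at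
coarse distance `≥ D`. Its `W = 0` slice is `dressedGaugeEngine_zero` (proved); for `W ≠ 0` it is
disagreement percolation / a graded cluster expansion with Peierls-rare configuration defects and
KP-small polymer activities (van den Berg–Maes 1994; Dobrushin–Shlosman 1985/1987;
Bertini–Cirillo–Olivieri 2005) — not a textbook theorem in this form. -/
def DressedGaugeEngine (d : ℕ) : Prop :=
  ∀ n : ℕ, 1 ≤ n → ∃ p₀ η₀ κ₀ : ℝ, 0 < p₀ ∧ 0 < η₀ ∧ 0 < κ₀ ∧
    ∀ ε : ℝ, 0 ≤ ε → 2 * ε * (shellCount d n : ℝ) ≤ 1 →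
    ∃ κₑ C₀ : ℝ, 0 < κₑ ∧ 0 ≤ C₀ ∧
    ∀ (G : Type) [Group G] [TopologicalSpace G] [IsTopologicalGroup G] [CompactSpace G]
      [MeasurableSpace G] [BorelSpace G] [SecondCountableTopology G] [MeasurableSingletonClass G]
      (Nρ : ℕ) (ρ : G →* Matrix (Fin Nρ) (Fin Nρ) ℂ), Continuous ρ →
    ∀ (N : ℕ) [NeZero N] (b : ℕ) (μc : Fin d → ℕ) (cell : Edge d N → CoarseIdx μc) (K : ℝ)
      (good : CoarseIdx μc → Set (GaugeConfig d N G)) (β κ η p : ℝ)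
      (W : QuasiLocalGaugePerturbation d N G b),
      1 ≤ b → (∀ i, 4 * n + 3 ≤ μc i + 1) → 0 ≤ K →
      (∀ A : Finset (Edge d N),
        ((A.image fun e => blockCorner b e.1).card : ℝ) ≤ K * cellCount cell A) →
      (∀ (D : ℕ) (e e' : Edge d N),
        (∀ i, (blockCorner b e'.1 i - blockCorner b e.1 i).val ≤ b * (2 * D + 1) ∨
          (blockCorner b e.1 i - blockCorner b e'.1 i).val ≤ b * (2 * D + 1)) →
        cdist (cell e') (cell e) ≤ D + 1) →
      IsSpecification ((0 : QuasiLocalGaugePerturbation d N G 1).kernel ρ β) →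
      IsSpecification (W.kernel ρ β) → IsGibbsMeasure (W.kernel ρ β) (W.perturbedMeasure ρ β) →
      IsGoodFS cell ((0 : QuasiLocalGaugePerturbation d N G 1).kernel ρ β) good n ε →
      0 ≤ p → p ≤ p₀ →
      UniformKernelPeierls cell ((0 : QuasiLocalGaugePerturbation d N G 1).kernel ρ β) good p →
      κ₀ ≤ κ → W.NormLE κ η → η * K ≤ η₀ →
      (∀ X : Finset (Site d N), X ∈ polymers b → (∃ U : GaugeConfig d N G, W.act X U ≠ 0) →
        ∀ y ∈ X, ∀ y' ∈ X, ∀ i : Fin d,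
          (y i - y' i).val ≤ b * X.card ∨ (y' i - y i).val ≤ b * X.card) →
      ∀ (f g : GaugeConfig d N G → ℝ) (Δf Δg : Finset (CoarseIdx μc)) (Bf Bg : ℝ) (D : ℕ),
        Measurable f → Measurable g → (∀ U, |f U| ≤ Bf) → (∀ U, |g U| ≤ Bg) →
        DependsOn f {e | cell e ∈ Δf} → DependsOn g {e | cell e ∈ Δg} →
        (∀ x ∈ Δf, ∀ y ∈ Δg, D ≤ cdist x y) →
          |∫ U, f U * g U ∂(W.perturbedMeasure ρ β) -
              (∫ U, f U ∂(W.perturbedMeasure ρ β)) * ∫ U, g U ∂(W.perturbedMeasure ρ β)| ≤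
            C₀ * Bf * Bg * Real.exp (Δf.card) * Δg.card * Real.exp (-(κₑ * D))

/-- **Deployment of the dressed engine** (reshape r5; statement of the CLOSED stub
`stub_deploymentDressed`): toolkit + dressed engine + UKP-certificate give uniform IR clustering of
the translation-invariant sup-small range-controlled cone for every decay rate `κ ≥ κ₀` (the
engine's threshold at the certificate's window), with a budget `η₁ > 0` and the certificate's scale
`c₁`. -/
def DeploymentDressed : Prop :=
  LocalACToolkit → DressedGaugeEngine 4 → WilsonGoodCertificateUKP →
    ∃ c₁ : ℝ, 0 < c₁ ∧ ∃ κ₀ : ℝ, 0 < κ₀ ∧ ∀ κ : ℝ, κ₀ ≤ κ →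
      ∃ η₁ : ℝ, 0 < η₁ ∧ IRConeClustering η₁ κ c₁

/-! ## Proof of `stub_deploymentDressed` -/

section Proof

/-- One level of the deployment with the engine factor `e^{|Δf|}` (a private copy of the landed
`level_bound_exp` of `…WilsonSlice`, kept here while that module is unbuilt on the farm): a
covariance bound `C₀ B_f B_g e^{|Δf|} |Δg| e^{-κₑ D}` for cell-local observables under `ν` on the
torus `2S+1` gives, for two species read through the periodic lift and the time shift `t ≤ S`, the
bound `C₀ C_A C_B e^{|supp A|} |supp B| e^{κₑ(δ₀+2)} e^{-(κₑ/6ℓ₀) a t}`. -/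
private theorem level_bound_exp_r5 {S b' μ : ℕ} {κₑ C₀ a ℓ₀ : ℝ} (hb' : 0 < b')
    (h2 : 2 * S + 1 < μ * b' + 2 * b')
    (hκₑ : 0 < κₑ) (hC₀ : 0 ≤ C₀) (hℓ₀ : 0 < ℓ₀) (h6 : (2 * b' : ℝ) * a ≤ 6 * ℓ₀)
    (ν : Measure (GaugeConfig 4 (2 * S + 1) SU3))
    (hcov : ∀ (f g : GaugeConfig 4 (2 * S + 1) SU3 → ℝ)
      (Δf Δg : Finset (CoarseIdx (fun _ : Fin 4 => μ))) (Bf Bg : ℝ) (D : ℕ),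
      Measurable f → Measurable g → (∀ σ, |f σ| ≤ Bf) → (∀ σ, |g σ| ≤ Bg) →
      DependsOn f {v | cellOf (prodFrame (2 * S + 1) b' μ) v ∈ Δf} →
      DependsOn g {v | cellOf (prodFrame (2 * S + 1) b' μ) v ∈ Δg} →
      (∀ x ∈ Δf, ∀ y ∈ Δg, D ≤ cdist x y) →
        |∫ σ, f σ * g σ ∂ν - (∫ σ, f σ ∂ν) * ∫ σ, g σ ∂ν| ≤
          C₀ * Bf * Bg * Real.exp (Δf.card) * Δg.card * Real.exp (-(κₑ * D)))
    (A B : YMSpecies SU3) {Ca Cb : ℝ} (hCa : ∀ U, |A.F U| ≤ Ca) (hCb : ∀ U, |B.F U| ≤ Cb) {t : ℕ}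
    (ht : t ≤ S) :
    |∫ U, A.F (torusLift (2 * S + 1) U) *
          B.F (configShift (-Pi.single 0 (t : ℤ)) (torusLift (2 * S + 1) U)) ∂ν -
        (∫ U, A.F (torusLift (2 * S + 1) U) ∂ν) *
          ∫ U, B.F (configShift (-Pi.single 0 (t : ℤ)) (torusLift (2 * S + 1) U)) ∂ν| ≤
      C₀ * Ca * Cb * Real.exp (A.supp.card) * B.supp.card *
        Real.exp (κₑ * (((A.supp.sup fun e => (e.1 0).natAbs) +
          (B.supp.sup fun e => (e.1 0).natAbs) + 2 : ℕ) : ℝ)) *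
        Real.exp (-(κₑ / (6 * ℓ₀) * (a * t))) := by
  have hf : Measurable fun U : GaugeConfig 4 (2 * S + 1) SU3 => A.F (torusLift (2 * S + 1) U) :=
    A.measurable.comp (measurable_torusLift _)
  have hg : Measurable fun U : GaugeConfig 4 (2 * S + 1) SU3 =>
      B.F (configShift (-Pi.single (0 : Fin 4) (t : ℤ)) (torusLift (2 * S + 1) U)) :=
    B.measurable.comp ((configShift _).measurable.comp (measurable_torusLift _))
  have hmain := hcov _ _ _ _ Ca Cb _ hf hg (fun U => hCa _) (fun U => hCb _)
    (dependsOn_comp_torusLift A.isCylinder _)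
    (dependsOn_comp_configShift_torusLift B.isCylinder _ _)
    (le_cdist_cellOf_torusEdge_timeShift hb' h2 A.supp B.supp ht)
  refine hmain.trans ?_
  have hCa0 : 0 ≤ Ca := (abs_nonneg _).trans (hCa fun _ => 1)
  have hCb0 : 0 ≤ Cb := (abs_nonneg _).trans (hCb fun _ => 1)
  have hΔf : Real.exp ((A.supp.image fun e => cellOf (prodFrame (2 * S + 1) b' μ)
      (torusEdge (2 * S + 1) e)).card : ℝ) ≤ Real.exp (A.supp.card : ℝ) :=
    Real.exp_le_exp.2 (by exact_mod_cast Finset.card_image_le)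
  have hΔg : ((B.supp.image fun e => cellOf (prodFrame (2 * S + 1) b' μ)
      (torusEdge (2 * S + 1) (e.1 - -Pi.single (0 : Fin 4) (t : ℤ), e.2))).card : ℝ) ≤
      B.supp.card := by
    exact_mod_cast Finset.card_image_le
  have hnum := final_numeric (t := t)
    (δ₀ := (A.supp.sup fun e => (e.1 0).natAbs) + (B.supp.sup fun e => (e.1 0).natAbs))
    (a := a) hκₑ hℓ₀ hb' h6
  have hK : 0 ≤ C₀ * Ca * Cb := by positivity
  generalize (A.supp.image fun e => cellOf (prodFrame (2 * S + 1) b' μ)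
      (torusEdge (2 * S + 1) e)).card = cf at *
  generalize (B.supp.image fun e => cellOf (prodFrame (2 * S + 1) b' μ)
      (torusEdge (2 * S + 1) (e.1 - -Pi.single (0 : Fin 4) (t : ℤ), e.2))).card = cg at *
  generalize t / (2 * b') -
    ((A.supp.sup fun e => (e.1 0).natAbs) + (B.supp.sup fun e => (e.1 0).natAbs) + 1) = D at *
  have hprod := mul_le_mul hΔf hΔg (Nat.cast_nonneg _) (Real.exp_pos _).le
  have hE : 0 ≤ Real.exp (-(κₑ * D)) := (Real.exp_pos _).le
  calc C₀ * Ca * Cb * Real.exp (cf : ℝ) * cg * Real.exp (-(κₑ * D))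
      = (C₀ * Ca * Cb) * (Real.exp (cf : ℝ) * cg) * Real.exp (-(κₑ * D)) := by ring
    _ ≤ (C₀ * Ca * Cb) * (Real.exp (A.supp.card : ℝ) * B.supp.card) * Real.exp (-(κₑ * D)) :=
        mul_le_mul_of_nonneg_right (mul_le_mul_of_nonneg_left hprod hK) hE
    _ ≤ (C₀ * Ca * Cb) * (Real.exp (A.supp.card : ℝ) * B.supp.card) *
        (Real.exp (κₑ * (((A.supp.sup fun e => (e.1 0).natAbs) +
          (B.supp.sup fun e => (e.1 0).natAbs) + 2 : ℕ) : ℝ)) *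
          Real.exp (-(κₑ / (6 * ℓ₀) * (a * t)))) :=
        mul_le_mul_of_nonneg_left hnum (by positivity)
    _ = _ := by ring

/-- **`stub_deploymentDressed` (CLOSED)**: toolkit + dressed engine + UKP-certificate give uniform IR
clustering of the translation-invariant sup-small range-controlled cone for every `κ ≥ κ₀(n)`.
Constants: the certificate's window `n`; the engine's thresholds `(p₀, η₀, κ₀)` at `n`; the
certificate's `(ε₀, c₁)` at rarity `p₀` (`2ε₀·shellCount ≤ 1`); the engine's `(κₑ, C₀)` at `ε₀`;
budget `η₁ := η₀/10⁴` (blocks per cell `K = 10⁴`); `Δ = κₑ/(6ℓ₀)`; frames of scale `⌈2ℓ₀/a_k⌉`. In the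
IR regime `Λ'ℓ₀ ≥ c₁`, eventually in `k`, on the torus `2S+1 ≥ 2L_k+1` the engine is called on the
cone member `w` itself (its kernels are `spec ρ₃ β w`, Wilson's are `wilsonSpec ρ₃ β`, DLR by toolkit
(c)); (h1) turns D1's `connectedCorr` into the covariance (`connectedCorr_eq_covCorr`). -/
theorem stub_deploymentDressed : DeploymentDressed := by
  rintro ⟨-, -, hDLR⟩ hE ⟨n, hn, hcert⟩
  obtain ⟨p₀, η₀, κ₀, hp₀, hη₀, hκ₀, heng⟩ := hE n hn
  obtain ⟨ε₀, c₁, hε₀, hshell, hc₁, hcert⟩ := hcert p₀ hp₀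
  obtain ⟨κₑ, C₀, hκₑ, hC₀, hEng⟩ := heng ε₀ hε₀ hshell
  refine ⟨c₁, hc₁, κ₀, hκ₀, fun κ hκ => ⟨η₀ / 10 ^ 4, by positivity, ?_⟩⟩
  intro a L ha ha₀ haL β' Λ' hΛ' hβ ℓ₀ hℓ₀
  have hℓ₀pos : 0 < ℓ₀ := pos_of_mul_pos_right (hc₁.trans_le hℓ₀) hΛ'.le
  refine ⟨κₑ / (6 * ℓ₀), by positivity, fun A B => ?_⟩
  obtain ⟨Ca, hCa⟩ := A.bounded
  obtain ⟨Cb, hCb⟩ := B.bounded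
  refine ⟨C₀ * Ca * Cb * Real.exp (A.supp.card) * B.supp.card *
    Real.exp (κₑ * (((A.supp.sup fun e => (e.1 0).natAbs) +
      (B.supp.sup fun e => (e.1 0).natAbs) + 2 : ℕ) : ℝ)), ?_⟩
  have hev1 : ∀ᶠ k in atTop, a k ≤ min 1 ℓ₀ := ha₀.eventually_le_const (lt_min one_pos hℓ₀pos)
  have hev2 : ∀ᶠ k in atTop, (4 * (n : ℝ) + 3) * (2 * ℓ₀ + 1) ≤ a k * L k :=
    haL.eventually_ge_atTop _
  have hev3 := hcert a ha ha₀ β' Λ' hΛ' hβ (2 * (Λ' * ℓ₀)) (by linarith)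
  filter_upwards [hev1, hev2, hev3] with k hk1 hk2 hk3
  intro S hS w hw hrc hinv t ht
  obtain ⟨hb, hb', hbb, h2b, h1, h2, hμ, h6⟩ := level_numerics (n := n) (ha k)
    (hk1.trans (min_le_left _ _)) (hk1.trans (min_le_right _ _)) hk2 hS
  set b' := ⌈2 * ℓ₀ / a k⌉₊ with hb'def
  set μ := (2 * S + 1) / b' - 1 with hμdef
  have hCeq : ⌈2 * (Λ' * ℓ₀) / (Λ' * a k)⌉₊ = b' := by
    rw [hb'def]; congr 1; field_simp
  obtain ⟨good, hFS, -, hUKP⟩ := hk3 S (fun _ => μ) (prodFrame (2 * S + 1) b' μ) (fun _ => hμ)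
    (fun _ => by rw [hCeq]; exact isTorusFrame_axisFrame hb' h1 h2)
  -- DLR inputs (toolkit (c)): the dressed kernels `spec ρ₃ β w = w.kernel ρ₃ β` and Wilson's
  have hρ : Continuous ρ₃ := continuous_fundamentalRep _
  obtain ⟨hspw, hgw⟩ := hDLR SU3 3 ρ₃ hρ (2 * S + 1) _ (β' k) w
  obtain ⟨hsp0, -⟩ := hDLR SU3 3 ρ₃ hρ (2 * S + 1) 1 (β' k) 0
  -- blocks per cell and block-to-cell nearness for the product frames
  have hK : ∀ A : Finset (Edge 4 (2 * S + 1)),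
      ((A.image fun e => blockCorner ⌊ℓ₀ / a k⌋₊ e.1).card : ℝ) ≤
        10 ^ 4 * cellCount (cellOf (prodFrame (2 * S + 1) b' μ)) A := fun A => by
    exact_mod_cast card_image_blockCorner_le_mul_cellCount (μ := μ) hb hb' hbb h2 A
  have hcon := cdist_cellOf_le_of_blockCorner_near (d := 4) (μ := μ) hb hb' h2b h1
  have hηK : η₀ / 10 ^ 4 * 10 ^ 4 ≤ η₀ := (div_mul_cancel₀ η₀ (by norm_num : (10 : ℝ) ^ 4 ≠ 0)).le
  -- the dressed engine at this level, for the covariance; (h1) turns `connectedCorr` into it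
  rw [w.connectedCorr_eq_covCorr ρ₃ (β' k) hinv, w.covCorr_eq_integral]
  exact level_bound_exp_r5 hb' h2 hκₑ hC₀ hℓ₀pos h6 _
    (hEng SU3 3 ρ₃ hρ (2 * S + 1) ⌊ℓ₀ / a k⌋₊ (fun _ => μ) (cellOf (prodFrame (2 * S + 1) b' μ))
      (10 ^ 4) good (β' k) κ (η₀ / 10 ^ 4) p₀ w hb (fun _ => hμ) (by norm_num) hK hcon hsp0 hspw
      hgw hFS hp₀.le le_rfl hUKP hκ hw hηK hrc)
    A B hCa hCb ht

end Proof

/-! ## Non-vacuity: the `W = 0` slice of the dressed engine, in every dimension -/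

/-- **The `W = 0` slice of the dressed engine (every dimension `d`)**: at `W = 0` the body of
`DressedGaugeEngine d` holds, with thresholds `p₀ = q₀(d, n)` of the block-Markov engine, any
`η₀, κ₀ > 0`, and constants `(κₑ, 2C)`: Wilson's kernels are block-Markov through the cells
(`hasBlockLeak_kernel_zero`), the PROVED engine
`Literature.Probability.LatticeModels.annealed_influence_markov_defects` bounds the averaged boundary
influence of `[0,1]`-valued cell-local observables by `C e^{|Δf|} |Δg| e^{-κₑ D}`, and the DLR
covariance bound (`abs_covariance_le_integral_abs`) with the affine rescaling of `f`
(`integral_abs_kernel_sub_rescale`) turns it into covariance decay under the (Gibbs) measure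
`μ_{β,0}`. This is the content of the landed `…WilsonSlice` size theorem, in the engine's own
quantifier shape. -/
theorem dressedGaugeEngine_zero (d n : ℕ) :
    ∃ p₀ : ℝ, 0 < p₀ ∧ ∀ ε : ℝ, 0 ≤ ε → 2 * ε * (shellCount d n : ℝ) ≤ 1 →
    ∃ κₑ C₀ : ℝ, 0 < κₑ ∧ 0 ≤ C₀ ∧
    ∀ (G : Type) [Group G] [TopologicalSpace G] [IsTopologicalGroup G] [CompactSpace G]
      [MeasurableSpace G] [BorelSpace G] [SecondCountableTopology G] [MeasurableSingletonClass G]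
      (Nρ : ℕ) (ρ : G →* Matrix (Fin Nρ) (Fin Nρ) ℂ), Continuous ρ →
    ∀ (N : ℕ) [NeZero N] (b : ℕ) (μc : Fin d → ℕ) (cell : Edge d N → CoarseIdx μc) (K : ℝ)
      (good : CoarseIdx μc → Set (GaugeConfig d N G)) (β p : ℝ),
      1 ≤ b → (∀ i, 4 * n + 3 ≤ μc i + 1) →
      (∀ A : Finset (Edge d N),
        ((A.image fun e => blockCorner b e.1).card : ℝ) ≤ K * cellCount cell A) →
      (∀ (D : ℕ) (e e' : Edge d N),
        (∀ i, (blockCorner b e'.1 i - blockCorner b e.1 i).val ≤ b * (2 * D + 1) ∨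
          (blockCorner b e.1 i - blockCorner b e'.1 i).val ≤ b * (2 * D + 1)) →
        cdist (cell e') (cell e) ≤ D + 1) →
      IsSpecification ((0 : QuasiLocalGaugePerturbation d N G 1).kernel ρ β) →
      IsGibbsMeasure ((0 : QuasiLocalGaugePerturbation d N G 1).kernel ρ β)
        ((0 : QuasiLocalGaugePerturbation d N G 1).perturbedMeasure ρ β) →
      IsGoodFS cell ((0 : QuasiLocalGaugePerturbation d N G 1).kernel ρ β) good n ε →
      0 ≤ p → p ≤ p₀ →
      UniformKernelPeierls cell ((0 : QuasiLocalGaugePerturbation d N G 1).kernel ρ β) good p →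
      ∀ (f g : GaugeConfig d N G → ℝ) (Δf Δg : Finset (CoarseIdx μc)) (Bf Bg : ℝ) (D : ℕ),
        Measurable f → Measurable g → (∀ U, |f U| ≤ Bf) → (∀ U, |g U| ≤ Bg) →
        DependsOn f {e | cell e ∈ Δf} → DependsOn g {e | cell e ∈ Δg} →
        (∀ x ∈ Δf, ∀ y ∈ Δg, D ≤ cdist x y) →
          |∫ U, f U * g U ∂((0 : QuasiLocalGaugePerturbation d N G 1).perturbedMeasure ρ β) -
              (∫ U, f U ∂((0 : QuasiLocalGaugePerturbation d N G 1).perturbedMeasure ρ β)) *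
                ∫ U, g U ∂((0 : QuasiLocalGaugePerturbation d N G 1).perturbedMeasure ρ β)| ≤
            C₀ * Bf * Bg * Real.exp (Δf.card) * Δg.card * Real.exp (-(κₑ * D)) := by
  obtain ⟨q₀, κₑ, C, hq₀, hκₑ, hC, hEng⟩ :=
    Literature.Probability.LatticeModels.annealed_influence_markov_defects.{0, 0} d n
  refine ⟨q₀, hq₀, fun ε hε hshell => ⟨κₑ, 2 * C, hκₑ, by positivity, ?_⟩⟩
  intro G _ _ _ _ _ _ _ _ Nρ ρ hρ N _ b μc cell K good β p hb hμc hK hcon hsp0 hg0 hFS hp hpp₀ hUKP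
    f g Δf Δg Bf Bg D hf hg hfB hgB hfdep hgdep hD
  have hshell' : ε * (shellCount d n : ℝ) ≤ 3 / 4 := by
    have := (shellCount d n).cast_nonneg (α := ℝ)
    nlinarith
  have hBL : HasBlockLeak cell ((0 : QuasiLocalGaugePerturbation d N G 1).kernel ρ β) 0 1 :=
    QuasiLocalGaugePerturbation.hasBlockLeak_kernel_zero ρ hρ hb _ hK hcon β zero_le_one
  haveI := hg0.isProbabilityMeasure
  set ν := (0 : QuasiLocalGaugePerturbation d N G 1).perturbedMeasure ρ β with hν
  have hcore := hEng cell _ good ν ε p 1 hμc hsp0 hg0 hε hshell' hFS hBL hp hpp₀ hUKP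
  -- covariance ≤ averaged boundary influence, rescaled (as in `abs_covariance_le_of_annealed_influence`)
  set Λ : Finset (Edge d N) := Finset.univ.filter fun v => cell v ∉ Δg with hΛ
  have hgdep' : DependsOn g ((↑Λ : Set (Edge d N))ᶜ) := by
    refine fun σ τ hστ => hgdep fun v hv => hστ v ?_
    intro hvΛ
    exact (Finset.mem_filter.1 (Finset.mem_coe.1 hvΛ)).2 hv
  obtain ⟨σ₀⟩ : Nonempty (GaugeConfig d N G) := by
    obtain ⟨σ, -⟩ := nonempty_of_measure_ne_zero (μ := ν) (s := Set.univ) (by simp)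
    exact ⟨σ⟩
  have hBf : 0 ≤ Bf := (abs_nonneg _).trans (hfB σ₀)
  have hBg : 0 ≤ Bg := (abs_nonneg _).trans (hgB σ₀)
  have hcov := abs_covariance_le_integral_abs hsp0 hg0 Λ hf hg hfB hgB hgdep'
  have hRHS : 0 ≤ 2 * C * Bf * Bg * Real.exp (Δf.card) * Δg.card * Real.exp (-(κₑ * D)) := by
    positivity
  rcases hBf.eq_or_lt with hBf0 | hBfpos
  · have hf0 : ∀ σ, f σ = 0 := fun σ => abs_nonpos_iff.1 (hBf0 ▸ hfB σ)
    have : ∫ σ, f σ * g σ ∂ν - (∫ σ, f σ ∂ν) * ∫ σ, g σ ∂ν = 0 := by simp [hf0]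
    rw [this, abs_zero]
    exact hRHS
  · set f' : GaugeConfig d N G → ℝ := fun σ => (f σ / Bf + 1) / 2 with hf'
    have hf'm : Measurable f' := ((hf.div_const Bf).add_const 1).div_const 2
    have hf'01 : ∀ σ, 0 ≤ f' σ ∧ f' σ ≤ 1 := fun σ => by
      have h := hfB σ
      rw [abs_le] at h
      have hlo : -1 ≤ f σ / Bf := by rw [le_div_iff₀ hBfpos]; linarith [h.1]
      have hhi : f σ / Bf ≤ 1 := by rw [div_le_iff₀ hBfpos]; linarith [h.2]
      simp only [hf']
      constructor <;> linarith
    have hf'dep : DependsOn f' {v | cell v ∈ Δf} := fun σ τ hστ => by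
      simp only [hf', hfdep hστ]
    have hcore' := hcore f' Δf Δg D hf'm hf'01 hf'dep hD
    have hresc := integral_abs_kernel_sub_rescale hsp0 (ν := ν) Λ hf hfB hBfpos
    calc |∫ σ, f σ * g σ ∂ν - (∫ σ, f σ ∂ν) * ∫ σ, g σ ∂ν|
        ≤ Bg * ∫ ζ, |∫ σ, f σ ∂((0 : QuasiLocalGaugePerturbation d N G 1).kernel ρ β Λ ζ) -
            ∫ σ, f σ ∂ν| ∂ν := hcov
      _ = Bg * (2 * Bf * ∫ ζ, |∫ σ, f' σ ∂((0 : QuasiLocalGaugePerturbation d N G 1).kernel ρ β Λ ζ) -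
            ∫ σ, f' σ ∂ν| ∂ν) := by rw [hresc]
      _ ≤ Bg * (2 * Bf * (C * Real.exp (Δf.card) * Δg.card * Real.exp (-(κₑ * D)))) := by gcongr
      _ = 2 * C * Bf * Bg * Real.exp (Δf.card) * Δg.card * Real.exp (-(κₑ * D)) := by ring

end Summit.QuantumFields.QCD.Cruxes.RobustYangMills.LocalAcOpenCertificate

end
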